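import Summits.HodgeConjecture.HodgeConjecture.Theorems.Ring2AbelianAllAndreStablyNondegenerateAnchors
import Summits.HodgeConjecture.HodgeConjecture.Theorems.Ring2AbelianAllAndreSplitTypeTransport
import Summits.HodgeConjecture.HodgeConjecture.Theorems.Ring2AbelianAllAndreTwistedSquareAnchors
import Summits.HodgeConjecture.HodgeConjecture.Theorems.Ring2AbelianAllWeilDiscriminantDescent
import Literature.AlgebraicGeometry.HodgeTheory.WeilTypeProducts
import HarnessLib

/-!
# Ring 2 · AbelianAll — ANDRÉ AXIS, PART O-c: THE W₆ ROWS THROUGH A TWISTED-SQUARE ANCHOR `B × B̄`, and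
  «NON-SPLIT IS CONSTANT ALONG THE PENCIL» (owed item (o155), pencil level; RING2-MAP AA2.366 (b) in the kernel)

HONEST FRAMING (sub-cell `pub-hodge-ring2-ab-*`, verbatim): research route, not a corollary; conditional on HC_CM plus
one named minimal statement. (Cell `pub-hodge-ring2`, verbatim: research route conditional on HC_CM; not a corollary;
Q11.4-sentence-2 already refuted in dim ≥ 3.) `HC_CM` does not occur in this file: the anchor is UNCONDITIONAL. No definition,
no named fact, no `sorry`. Binders displayed where used: Verdier's generic local triviality (the ⟸ halves only), the pencil
structure of parts XL/XLI (θ_N-datum `ν`, group law `mS`, rank data), the `K`-charts.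

CONTEXT. Part N (gen 44) proved, for a compact pencil `f : 𝒳 ⟶ S` of `ℚ(√−d_K)`-Weil `(2q+2)`-folds with its `K`-action (global `Φ`,
`K`-compatible charts `(A_s, e_s, φ_s)`) through ONE chart satisfying the Hodge conjecture, `B⋆(𝒳) ∀η ⟹ W(A_s, φ_s) ⊆ N^{q+1}(A_s)` for
EVERY member (fact-free) and `⟺` modulo Verdier — with the Weil datum `hWt : IsWeilType (A_t) (φ_t)` at the charted member as a
HYPOTHESIS, and with the non-split habitat («these pencils lie on the non-split components `(3, d_K, δ)`») on paper only
(RING2-MAP AA2.361/AA2.366 (b)). Part O-a/O-b (this gen) typed the anchors: every twisted square `(T × T, φ × (−φ))` is of Weil type,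
the weight-`m` polarized one has `det H = [(−m)^g]`, non-split for `g` odd and `m ∉ Nm(K_dˣ)`, and HC holds on it for prime-dimensional
CM `T`. Here the pencil rows:

* §1 (AV) `isWeilType_of_isogeny_twistedSquare`, `hodgeConjectureFor_of_isogeny_twistedSquare_of_endField` / `…_ellipticPower`:
  a pair `(A, ψ)` `K`-ISOGENOUS to a twisted square (`gT : A ⟶ T × T` an isogeny, `gT ≫ Φ = ψ ≫ gT`) is of Weil type `(g, d)`, and
  satisfies HC when `dim T` is prime with a number field of degree `2 dim T` in `End⁰(T)`, or when `T = E₀^{n+1}` (Deligne's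
  `Eⁿ⁺¹ × Ēⁿ⁺¹`); `hasWeilDiscriminantNondeg_of_isogeny_twistedSquare`: it inherits the discriminant class of `gT^*h` (van Geemen
  5.2 (3) on the carriers, ab-weil-1).
* §2 **`not_isHyperbolicWeilType_member_of_member` — NON-SPLIT (POLARIZED) IS CONSTANT ALONG THE PENCIL**, the companion of part
  L-g's `isSplitWeilType_member_of_member`: on a compact abelian pencil with a `K`-action, a projective embedding `E` of `𝒳` and a
  rational ambient `a ≠ 0` (`H_K = d_K·E^*a + Φ^*E^*a`), if `(A_t, φ_t, e_t^*(H_K|X_t))` has a non-degenerate discriminant witness of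
  class `δ ≠ [(−1)ⁿ]` at ONE member, then at EVERY member `(A_s, φ_s, e_s^*(H_K|X_s))` has class `δ` (part L-a) and is NOT
  hyperbolic (the member embedding `e_s ≫ ι_s ≫ E` of part L-b realises `e_s^*(H_K|X_s)` as a `K`-symmetrised hyperplane class;
  van Geemen (5.4.1) contrapositive) — FACT-FREE.
* §3 **THE ROWS THROUGH A TWISTED-SQUARE CHART** (chart at `t` `K`-isogenous to `(T × T, φ_T × (−φ_T))`, `dim T = q + 1`):
  `weilClassesOf_le_algebraicClasses_forall_of_lefschetzB_of_twistedSquareChart` — **`B⋆(𝒳) ∀η ⟹ W(A_s, φ_s) ⊆ N^{q+1}(A_s)` for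
  EVERY member, FACT-FREE, when `dim T` is prime with a number field of degree `2 dim T` in `End⁰(T)`** (part N §3 with BOTH its
  chart hypotheses — HC and Weil type at the chart — DISCHARGED by §1); `…_of_ellipticPowerTwistedSquareChart` — the same through
  `E₀^{q+1} × Ē₀^{q+1}`, every `q`, every elliptic curve; `lefschetzB_weilPencil_iff_…_of_twistedSquareChart_of_verdier`
  — the `⟺` with the pencil structure, modulo Verdier; W₆: `…sixfoldPencil…_of_cmThreefoldTwistedSquareChart…` (`T` a threefold
  with a sextic number field in `End⁰(T)`: the anchors `B × B̄`, `E³ × Ē³`).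
* §4 **THE NON-SPLIT HABITAT, KERNEL FORM (AA2.366 (b))**: `nonsplit_weilSixfoldPencil_of_twistedSquareChart` — if moreover the
  relative polarization restricts on the chart to `gT^*h` for a class `h` of `(T × T, Φ_T)` of discriminant class `[−m]`,
  `m ∉ Nm(K_dˣ)` (part O-a: the weight-`m` Segre class), then EVERY member `(A_s, φ_s)` is a Weil sixfold (part L-d), polarized by
  `e_s^*(H_K|X_s)` of class `[−m]`, NOT hyperbolic: the whole pencil lies on the non-split polarized component `(3, d_K, [−m])`, and
  on it `B⋆` of the ONE 7-fold `⟹` (fact-free) / `⟺` (Verdier) the Weil Hodge conjecture for every member — `HC_CM`, [Markman2025]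
  and every Hodge–Weil theorem in print idle.

HONEST REMARKS. Strength UNCHANGED: `⟸` is Weil-HC along the whole pencil (uncountably many non-split sixfolds of one class);
no case of HC beyond the anchor is claimed; nothing minimal claimed; N104 untouched. Existence of such pencils (a compact curve
in the non-split component through `B × B̄` carrying a family with global `K`-action) is NOT constructed here — pencils are
hypotheses throughout the axis ([h₂₁]-type inputs); what is proved is what `B⋆` of their total space means.

## References

* [vanGeemen1994HodgeAV] B. van Geemen, LNM 1594 (1994), 4.9–4.10, 4.14, Lemma 5.2 (3), 5.3–5.4 and (5.4.1).
* [Landherr1936HermitianForms] W. Landherr, Abh. Math. Sem. Hamburg 11 (1936) 245–248.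
* [Gordon1999HodgeAVSurvey] B. Gordon (1999), Thm. 6.3 with Remark, Thm. 6.4, Thm. 7.5 (1), Def. 7.6. [Yanai1985] Remark (p. 172).
* [Andre1996Motifs] Y. André, Publ. Math. IHÉS 83 (1996), Prop. 3.3, §6.3 Lemme 6.3.1, Lemme 6.3.3 and Remarque 2 (pp. 21–22, 31–33).
* [Tankeev2008] S. G. Tankeev, Izv. Math. 72 (2008), Thm. (i)–(ii). [Verdier1976] J.-L. Verdier, Invent. Math. 36 (1976), Cor. (5.1).
* [VoisinHodgeI2002] C. Voisin, Hodge Theory I (2002), Thm. 9.3 and §9.2.1. [DeligneHodgeII1971] P. Deligne, (4.1.3.1).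
-/

set_option linter.dupNamespace false

noncomputable section

namespace Summit.HodgeConjecture.HodgeConjecture.Ring2.AbelianAll

open CategoryTheory CategoryTheory.Limits AlgebraicGeometry MonoidalCategory CartesianMonoidalCategory
open Literature.AlgebraicGeometry Literature.AlgebraicGeometry.Motives
open Literature.AlgebraicGeometry.HodgeTheory Literature.AlgebraicGeometry.VanGeemen1994
open Literature.AlgebraicGeometry.ComplexMultiplication (EndFieldFullDegree.isStablyNondegenerate_of_prime)
open Literature.AlgebraicTopology.SingularHomology (singularCohomology)
open Summit.HodgeConjecture.HodgeConjecture.Theses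
open Summit.HodgeConjecture.CorCM.Model

/-! ## §1 Pairs `K`-isogenous to a twisted square -/

section Isogenous

variable {A T : AbelianVariety ℂ} {ψ : A ⟶ A} {φ : T ⟶ T} {g d : ℕ}

/-- **A pair `(A, ψ)` `K`-isogenous to a twisted square `(T × T, φ × (−φ))` is of Weil type `(g, d)`** (`dim T = g ≥ 1`, `φ² = −d`,
`ψ² = −d`, `gT : A ⟶ T × T` an isogeny with `gT ≫ Φ = ψ ≫ gT`): part O-a's `isWeilType_twistedSquare` and «Weil type is a `K`-isogeny
invariant» (`IsWeilType.of_isIsogeny'`). The chart hypothesis `hWt` of parts M-d/N at a `B × B̄` anchor, discharged.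
[cite: vanGeemen1994HodgeAV, 4.9 and 4.14] [cite: MoonenZarhin1999LowDim, (1.9)] -/
theorem isWeilType_of_isogeny_twistedSquare (hg : 0 < g) (hT : T.dim = g) (hd : 0 < d) (hφ : φ ≫ φ = -(d • 𝟙 T))
    (hψ : ψ ≫ ψ = -(d • 𝟙 A)) (gT : A ⟶ T.prod T) (hγ : AbelianVariety.IsIsogeny gT)
    (hcomm : gT ≫ AbelianVariety.prodLift (AbelianVariety.fst T T ≫ φ) (AbelianVariety.snd T T ≫ (-φ)) = ψ ≫ gT) :
    IsWeilType A ψ g d :=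
  (isWeilType_twistedSquare hg hT hd hφ).of_isIsogeny' gT hγ hcomm hψ

/-- **… and satisfies the Hodge conjecture when `dim T` is PRIME and `End⁰(T)` contains a number field of degree `2 dim T`**
(`T` stably nondegenerate, `A ∼ T × T = T.powSucc 1`; HC is isogeny invariant): the anchors `B × B̄` (CM threefold `B`) and
`E³ × Ē³` UP TO ISOGENY, unconditionally. [cite: Gordon1999HodgeAVSurvey, Thm. 6.3 with Remark, Thm. 6.4, Thm. 7.5 (1) and Def. 7.6]
[cite: Yanai1985, Remark (p. 172)] -/
theorem hodgeConjectureFor_of_isogeny_twistedSquare_of_endField (gT : A ⟶ T.prod T) (hγ : AbelianVariety.IsIsogeny gT)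
    {F : Type} [Field F] [NumberField F] (ιF : F →+* T.endAlgebra) (hF : Module.finrank ℚ F = 2 * T.dim) (hp : T.dim.Prime) :
    HodgeConjectureFor A.dim A.X :=
  (EndFieldFullDegree.isStablyNondegenerate_of_prime ιF hF hp).hodgeConjectureFor_of_isIsogenous_powSucc (N := 1) ⟨gT, hγ⟩

/-- **… and when `T = E₀^{n+1}` is a power of an elliptic curve** (Deligne's anchors `Eⁿ⁺¹ × Ēⁿ⁺¹`, any `K`-structure): HC for every
`A ∼ E₀^{n+1} × E₀^{n+1} = (E₀.powSucc n).powSucc 1` — the tree's `Deligne1982.hodgeConjectureFor_powSucc_powSucc` (powers of powers of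
an elliptic curve; fact-free) and isogeny invariance. [cite: vanGeemen1994HodgeAV, Thm. 4.3] [cite: Andre1996Motifs, §6.3 Lemme 6.3.3 (p. 33)]
[cite: Deligne1982HodgeCycles, §4 Remark 4.10] -/
theorem hodgeConjectureFor_of_isogeny_twistedSquare_ellipticPower {E₀ : AbelianVariety ℂ} (hE : E₀.dim = 1) (n : ℕ)
    (gT : A ⟶ (E₀.powSucc n).prod (E₀.powSucc n)) (hγ : AbelianVariety.IsIsogeny gT) : HodgeConjectureFor A.dim A.X :=
  HodgeConjectureFor.of_isIsogenous ⟨gT, hγ⟩ (Deligne1982.hodgeConjectureFor_powSucc_powSucc hE n 1)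

/-- **… and inherits the discriminant class of `gT^*h`**: if `(T × T, Φ, h)` has a non-degenerate discriminant witness of class `δ`,
so has `(A, ψ, gT^*h)` (van Geemen 5.2 (3), `det H` is an isogeny invariant — ab-weil-1's carrier theorem).
[cite: vanGeemen1994HodgeAV, Lemma 5.2 (3)] -/
theorem hasWeilDiscriminantNondeg_of_isogeny_twistedSquare {n : ℕ} (gT : A ⟶ T.prod T) (hγ : AbelianVariety.IsIsogeny gT)
    (hcomm : gT ≫ AbelianVariety.prodLift (AbelianVariety.fst T T ≫ φ) (AbelianVariety.snd T T ≫ (-φ)) = ψ ≫ gT)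
    {h : complexBetti (T.prod T).X 2} {δ : weilNormResidueGroup d}
    (hδ : HasWeilDiscriminantNondeg (T.prod T)
      (AbelianVariety.prodLift (AbelianVariety.fst T T ≫ φ) (AbelianVariety.snd T T ≫ (-φ))) n d h δ) :
    HasWeilDiscriminantNondeg A ψ n d (complexBetti.map gT.hom.hom.hom 2 h) δ :=
  (hasWeilDiscriminantNondeg_iff_of_isIsogeny hγ hcomm).1 hδ

end Isogenous

/-! ## §2 Non-split (polarized) is constant along the pencil -/

section Nonsplit

variable {𝒳 S : SchemeOver ℂ} {f : 𝒳 ⟶ S} {d : ℕ}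

/-- **NON-SPLIT IS CONSTANT ALONG THE PENCIL** (companion of part L-g's `isSplitWeilType_member_of_member`; fact-free). Compact abelian
pencil `f : 𝒳 ⟶ S`, endomorphism `Φ` over `S`, charts `e_s : A_s ≅ X_s` with `φ_s² = −d_K` compatible with `Φ`, a projective embedding
`E` of `𝒳` with a rational ambient class `a ≠ 0`, `H_K = d_K·E^*a + Φ^*E^*a`. If at ONE member `t` (`dim A_t = 2n`, `n, d_K ≥ 1`)
the class `e_t^*(H_K|X_t)` carries a non-degenerate discriminant witness of class `δ ≠ [(−1)ⁿ]`, then at EVERY member `s`: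
`e_s^*(H_K|X_s)` carries one of class `δ` (part L-a: parallel transport of the Gram data), it IS the `K`-symmetrised hyperplane class
of the member embedding `e_s ≫ ι_s ≫ E` (part L-b), and `(A_s, φ_s)` is NOT of hyperbolic Weil type for it (van Geemen (5.4.1):
hyperbolic forces `det H = [(−1)ⁿ]`, uniqueness of the class on the carriers). [cite: vanGeemen1994HodgeAV, Lemma 5.2 (3), 5.4 and (5.4.1)]
[cite: Landherr1936HermitianForms] [cite: VoisinHodgeI2002, Thm. 9.3 and §9.2.1] -/
theorem not_isHyperbolicWeilType_member_of_member (hf : IsCompactAbelianPencil f d) {n dK : ℕ} (hn : 0 < n) (hdK : 0 < dK)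
    (Φ : 𝒳 ⟶ 𝒳) (hΦ : Φ ≫ f = f)
    (A : ComplexPoints S → AbelianVariety ℂ) (e : ∀ s, (A s).X ≅ fiberOver f s) (φ : ∀ s, A s ⟶ A s)
    (hφ : ∀ s, φ s ≫ φ s = -(dK • 𝟙 (A s)))
    (hK : ∀ s, ∃ Φs : fiberOver f s ⟶ fiberOver f s, Φs ≫ fiberι f s = fiberι f s ≫ Φ ∧ (e s).hom ≫ Φs = (φ s).hom.hom.hom ≫ (e s).hom)
    (E : ProjectiveEmbedding 𝒳) {a : complexBetti (projectiveSpace E.n ℂ) 2} (ha : IsRationalClass a) (ha0 : a ≠ 0)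
    {t : ComplexPoints S} (hdim : (A t).dim = 2 * n) {δ : weilNormResidueGroup dK}
    (hδt : HasWeilDiscriminantNondeg (A t) (φ t) n dK (complexBetti.map (e t).hom 2 (complexBetti.map (fiberι f t) 2
      ((dK : ℂ) • complexBetti.map E.ι 2 a + complexBetti.map Φ 2 (complexBetti.map E.ι 2 a)))) δ)
    (hne : δ ≠ QuotientGroup.mk ((-1 : ℚˣ) ^ n)) (s : ComplexPoints S) :
    HasWeilDiscriminantNondeg (A s) (φ s) n dK (complexBetti.map (e s).hom 2 (complexBetti.map (fiberι f s) 2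
        ((dK : ℂ) • complexBetti.map E.ι 2 a + complexBetti.map Φ 2 (complexBetti.map E.ι 2 a)))) δ ∧
      ¬ IsHyperbolicWeilType (A s) (φ s) n (complexBetti.map (e s).hom 2 (complexBetti.map (fiberι f s) 2
        ((dK : ℂ) • complexBetti.map E.ι 2 a + complexBetti.map Φ 2 (complexBetti.map E.ι 2 a)))) := by
  haveI : IsProper S.hom := IsSmoothProjective.isProper_holds hf.isSmoothProjective_base
  -- the class at `s`
  have hδs := (hasWeilDiscriminantNondeg_member_iff hf Φ hΦ _ A e φ hK δ t s).1 hδt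
  refine ⟨hδs, ?_⟩
  -- `e_s^*(H_K|X_s)` is the `K`-symmetrised hyperplane class of the member embedding
  obtain ⟨Φs, hΦs, hes⟩ := hK s
  obtain ⟨es, aS, haS, haS0, hcs⟩ := exists_memberEmbedding E ha ha0 Φ (e s) hΦs hes dK
  have hds : (A s).dim = 2 * n := by
    rw [AbelianVariety.dim_eq_of_chart hf (A s) (e s), ← AbelianVariety.dim_eq_of_chart hf (A t) (e t), hdim]
  rw [← hcs] at hδs ⊢
  exact not_isHyperbolicWeilType_of_hasWeilDiscriminantNondeg_ne hn hds hdK (hφ s) es haS haS0 hδs hne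

end Nonsplit

/-! ## §3 The rows through a twisted-square chart -/

section Rows

variable {𝒳 S : SchemeOver ℂ} {f : 𝒳 ⟶ S}

open scoped MonObj

/-- `𝒴` — the fibre square `𝒳 ×_S 𝒳` (display notation for the tree's `familyPullback f f`). -/
local notation3 (prettyPrint := false) "𝒴[" f "]" => familyPullback f f
/-- `𝐚` — the first projection `𝒳 ×_S 𝒳 ⟶ 𝒳`. -/
local notation3 (prettyPrint := false) "𝐚[" f "]" => familyPullback.fst f f
/-- `𝐛` — the second projection `𝒳 ×_S 𝒳 ⟶ 𝒳`. -/
local notation3 (prettyPrint := false) "𝐛[" f "]" => familyPullback.snd f f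

/-- **`B⋆` OF THE TOTAL SPACE ⟹ THE WEIL HODGE CONJECTURE FOR EVERY MEMBER, through ONE chart `K`-isogenous to a twisted square
`T × T̄` of a prime-dimensional `T` with a number field of degree `2 dim T` in `End⁰(T)` — FACT-FREE, UNCONDITIONAL ANCHOR.**
Compact pencil of abelian `(2q+2)`-folds with a global endomorphism `Φ` over `S`, `K`-compatible charts `(A_s, e_s, φ_s)`, `φ_s² = −d_K`
(`d_K ≥ 1`), a global class `U₊` with `e_t^*(U₊|X_t) ∈ E₊(A_t, φ_t)` and `U₊|X_t ≠ 0` at the charted member `t`, whose chart is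
`K`-isogenous to `(T × T, φ_T × (−φ_T))` (`dim T = q + 1` prime, `φ_T² = −d_K`). Then `B⋆(𝒳, η) ∀η ⟹ W(A_s, φ_s) ⊆ N^{q+1}(A_s)`
for EVERY `s` — part N §3 with its two chart hypotheses discharged by §1 (Weil type; HC). No θ_N, no group law, no rank data,
no Verdier, no `HC_CM`. [cite: Andre1996Motifs, Prop. 3.3 (pp. 21–22) and §6.3 Remarque 2 (p. 33)] [cite: vanGeemen1994HodgeAV, 4.9–4.10]
[cite: Gordon1999HodgeAVSurvey, Thm. 6.3 with Remark, Thm. 6.4 and Thm. 7.5 (1)] -/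
theorem weilClassesOf_le_algebraicClasses_forall_of_lefschetzB_of_twistedSquareChart {q dK : ℕ} (hdK : 0 < dK)
    (hf : IsCompactAbelianPencil f (2 * q + 1 + 1)) (hB : ∀ ηX : complexBetti 𝒳 2, StandardConjectureBStar (2 * q + 1 + 1 + 1) 𝒳 ηX)
    (Φ : 𝒳 ⟶ 𝒳) (hΦ : Φ ≫ f = f)
    (A : ComplexPoints S → AbelianVariety ℂ) (e : ∀ s, (A s).X ≅ fiberOver f s) (φ : ∀ s, A s ⟶ A s)
    (hφ : ∀ s, φ s ≫ φ s = -(dK • 𝟙 (A s)))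
    (hK : ∀ s, ∃ Φs : fiberOver f s ⟶ fiberOver f s, Φs ≫ fiberι f s = fiberι f s ≫ Φ ∧ (e s).hom ≫ Φs = (φ s).hom.hom.hom ≫ (e s).hom)
    (Up : complexBetti 𝒳 (2 * (q + 1))) {t : ComplexPoints S}
    (hUpt : complexBetti.map (e t).hom (2 * (q + 1)) (complexBetti.map (fiberι f t) (2 * (q + 1)) Up) ∈ weilClassesPlus (A t) (φ t) (q + 1) dK)
    (hUp0 : complexBetti.map (fiberι f t) (2 * (q + 1)) Up ≠ 0)
    {T : AbelianVariety ℂ} {φT : T ⟶ T} (hT : T.dim = q + 1) (hφT : φT ≫ φT = -(dK • 𝟙 T))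
    (gT : A t ⟶ T.prod T) (hγ : AbelianVariety.IsIsogeny gT)
    (hcomm : gT ≫ AbelianVariety.prodLift (AbelianVariety.fst T T ≫ φT) (AbelianVariety.snd T T ≫ (-φT)) = φ t ≫ gT)
    {F : Type} [Field F] [NumberField F] (ιF : F →+* T.endAlgebra) (hF : Module.finrank ℚ F = 2 * T.dim) (hp : T.dim.Prime)
    (s : ComplexPoints S) : weilClassesOf (A s) (φ s) (q + 1) dK ≤ algebraicClasses (A s).X (q + 1) :=
  weilClassesOf_le_algebraicClasses_forall_of_lefschetzB_of_hodgeConjectureFor_chart hf hB Φ hΦ A e φ hφ hK Up hUpt hUp0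
    (isWeilType_of_isogeny_twistedSquare (by omega) hT hdK hφT (hφ t) gT hγ hcomm)
    (hodgeConjectureFor_of_isogeny_twistedSquare_of_endField gT hγ ιF hF hp) s

/-- **The same through a chart `K`-isogenous to a twisted square `E₀^{q+1} × Ē₀^{q+1}` of a power of an elliptic curve** (any
`K`-structure `φ_T` on `E₀^{q+1}` with `φ_T² = −d_K`; Deligne's anchors): `B⋆(𝒳, η) ∀η ⟹ W(A_s, φ_s) ⊆ N^{q+1}(A_s)` for EVERY member —
FACT-FREE (HC at the chart by `hodgeConjectureFor_powSucc_powSucc`, Weil type by §1; `dim E₀^{q+1} = q + 1` read off the chart and the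
isogeny). Part M-d's elliptic-power charts with the Weil datum at the anchor DISCHARGED. [cite: vanGeemen1994HodgeAV, Thm. 4.3 and 4.9–4.10]
[cite: Andre1996Motifs, §6.3 Lemme 6.3.3 and Remarque 2 (p. 33)] [cite: Deligne1982HodgeCycles, §4 Remark 4.10] -/
theorem weilClassesOf_le_algebraicClasses_forall_of_lefschetzB_of_ellipticPowerTwistedSquareChart {q dK : ℕ} (hdK : 0 < dK)
    (hf : IsCompactAbelianPencil f (2 * q + 1 + 1)) (hB : ∀ ηX : complexBetti 𝒳 2, StandardConjectureBStar (2 * q + 1 + 1 + 1) 𝒳 ηX)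
    (Φ : 𝒳 ⟶ 𝒳) (hΦ : Φ ≫ f = f)
    (A : ComplexPoints S → AbelianVariety ℂ) (e : ∀ s, (A s).X ≅ fiberOver f s) (φ : ∀ s, A s ⟶ A s)
    (hφ : ∀ s, φ s ≫ φ s = -(dK • 𝟙 (A s)))
    (hK : ∀ s, ∃ Φs : fiberOver f s ⟶ fiberOver f s, Φs ≫ fiberι f s = fiberι f s ≫ Φ ∧ (e s).hom ≫ Φs = (φ s).hom.hom.hom ≫ (e s).hom)
    (Up : complexBetti 𝒳 (2 * (q + 1))) {t : ComplexPoints S}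
    (hUpt : complexBetti.map (e t).hom (2 * (q + 1)) (complexBetti.map (fiberι f t) (2 * (q + 1)) Up) ∈ weilClassesPlus (A t) (φ t) (q + 1) dK)
    (hUp0 : complexBetti.map (fiberι f t) (2 * (q + 1)) Up ≠ 0)
    {E₀ : AbelianVariety ℂ} (hE : E₀.dim = 1) {φT : E₀.powSucc q ⟶ E₀.powSucc q} (hφT : φT ≫ φT = -(dK • 𝟙 (E₀.powSucc q)))
    (gT : A t ⟶ (E₀.powSucc q).prod (E₀.powSucc q)) (hγ : AbelianVariety.IsIsogeny gT)
    (hcomm : gT ≫ AbelianVariety.prodLift (AbelianVariety.fst _ _ ≫ φT) (AbelianVariety.snd _ _ ≫ (-φT)) = φ t ≫ gT)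
    (s : ComplexPoints S) : weilClassesOf (A s) (φ s) (q + 1) dK ≤ algebraicClasses (A s).X (q + 1) := by
  have h1 : (A t).dim = 2 * q + 1 + 1 := AbelianVariety.dim_eq_of_chart hf (A t) (e t)
  have h2 : (A t).dim = ((E₀.powSucc q).prod (E₀.powSucc q)).dim := AbelianVariety.dim_eq_of_isIsogeny hγ
  have hT : (E₀.powSucc q).dim = q + 1 := by rw [AbelianVariety.dim_prod, h1] at h2; omega
  exact weilClassesOf_le_algebraicClasses_forall_of_lefschetzB_of_hodgeConjectureFor_chart hf hB Φ hΦ A e φ hφ hK Up hUpt hUp0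
    (isWeilType_of_isogeny_twistedSquare (by omega) hT hdK hφT (hφ t) gT hγ hcomm)
    (hodgeConjectureFor_of_isogeny_twistedSquare_ellipticPower hE q gT hγ) s

/-- **`B⋆(𝒳, η) ∀η ⟺ W(A_s, φ_s) ⊆ N^{q+1}(A_s)` FOR EVERY MEMBER, through a chart `K`-isogenous to a twisted square `T × T̄` of a
prime-dimensional `T` with a number field of degree `2 dim T` in `End⁰(T)`** — with the pencil structure of parts XL/XLI (θ_N-datum
`ν`, group law `mS`, lines off the middle degree, no odd invariants, `Θ, U₊, U₋` spanning the middle invariants at `t`, `Θ|X_s`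
algebraic), modulo Verdier for `⟸`; Weil type and HC at the chart DISCHARGED (§1). No `HC_CM`, no Hodge–Weil theorem in print.
[cite: Tankeev2008, Thm. (i)–(ii)] [cite: Verdier1976, Cor. (5.1)] [cite: vanGeemen1994HodgeAV, 4.9–4.10 and Lemma 5.2 (6)]
[cite: Gordon1999HodgeAVSurvey, Thm. 6.3 with Remark, Thm. 6.4 and Thm. 7.5 (1)] -/
theorem lefschetzB_weilPencil_iff_forall_weilClasses_algebraic_of_twistedSquareChart_of_verdier
    (hGT : Verdier1976_genericLocalTriviality) {q dK : ℕ} (hdK : 0 < dK) (hf : IsCompactAbelianPencil f (2 * q + 1 + 1))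
    (t : ComplexPoints S) (ν : 𝒳 ⟶ 𝒳) (hν : ν ≫ f = f) {N : ℕ} (hN : 2 ≤ N)
    (hθ : ∀ s : ComplexPoints S, ∃ (νs : fiberOver f s ⟶ fiberOver f s) (A : AbelianVariety ℂ) (e : A.X ≅ fiberOver f s),
      νs ≫ fiberι f s = fiberι f s ≫ ν ∧ e.hom ≫ νs = (N • 𝟙 A).hom.hom.hom ≫ e.hom)
    (mS : 𝒴[f] ⟶ 𝒳)
    (hmν : (familyPullback.isPullback f f).lift (𝐚[f] ≫ ν) (𝐛[f] ≫ ν) (familyPullback_pair_condition hν) ≫ mS = mS ≫ ν)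
    (hchart : ∃ (νt : fiberOver f t ⟶ fiberOver f t) (A : AbelianVariety ℂ) (e : A.X ≅ fiberOver f t),
      νt ≫ fiberι f t = fiberι f t ≫ ν ∧ e.hom ≫ νt = (N • 𝟙 A).hom.hom.hom ≫ e.hom ∧
      (familyPullback.isPullback f f).lift (fst A.X A.X ≫ e.hom ≫ fiberι f t) (snd A.X A.X ≫ e.hom ≫ fiberι f t)
        (fibreChart_pair_condition t e) ≫ mS = μ[A.X] ≫ e.hom ≫ fiberι f t)
    (hRank : ∀ p : ℕ, 0 < p → p < 2 * q + 1 + 1 → p ≠ q + 1 →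
      Module.finrank ℂ (LinearMap.range (complexBetti.map (fiberι f t) (2 * p)).hom) = 1)
    (hOdd : ∀ k' : ℕ, Odd k' → k' ≤ 2 * (2 * q + 1 + 1) → ∀ W : complexBetti 𝒳 k', complexBetti.map (fiberι f t) k' W = 0)
    (Φ : 𝒳 ⟶ 𝒳) (hΦ : Φ ≫ f = f)
    (A : ComplexPoints S → AbelianVariety ℂ) (e : ∀ s, (A s).X ≅ fiberOver f s) (φ : ∀ s, A s ⟶ A s)
    (hφ : ∀ s, φ s ≫ φ s = -(dK • 𝟙 (A s)))
    (hK : ∀ s, ∃ Φs : fiberOver f s ⟶ fiberOver f s, Φs ≫ fiberι f s = fiberι f s ≫ Φ ∧ (e s).hom ≫ Φs = (φ s).hom.hom.hom ≫ (e s).hom)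
    (Θ Up Um : complexBetti 𝒳 (2 * (q + 1)))
    (hspan : ∀ W : complexBetti 𝒳 (2 * (q + 1)), ∃ a b c : ℂ, (complexBetti.map (fiberι f t) (2 * (q + 1))).hom W =
      a • (complexBetti.map (fiberι f t) (2 * (q + 1))).hom Θ + b • (complexBetti.map (fiberι f t) (2 * (q + 1))).hom Up +
        c • (complexBetti.map (fiberι f t) (2 * (q + 1))).hom Um)
    (hΘ : ∀ s : ComplexPoints S, (complexBetti.map (fiberι f s) (2 * (q + 1))).hom Θ ∈ algebraicClasses (fiberOver f s) (q + 1))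
    (hUpt : complexBetti.map (e t).hom (2 * (q + 1)) (complexBetti.map (fiberι f t) (2 * (q + 1)) Up) ∈ weilClassesPlus (A t) (φ t) (q + 1) dK)
    (hUmt : complexBetti.map (e t).hom (2 * (q + 1)) (complexBetti.map (fiberι f t) (2 * (q + 1)) Um) ∈ weilClassesMinus (A t) (φ t) (q + 1) dK)
    (hUp0 : complexBetti.map (fiberι f t) (2 * (q + 1)) Up ≠ 0)
    {T : AbelianVariety ℂ} {φT : T ⟶ T} (hT : T.dim = q + 1) (hφT : φT ≫ φT = -(dK • 𝟙 T))
    (gT : A t ⟶ T.prod T) (hγ : AbelianVariety.IsIsogeny gT)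
    (hcomm : gT ≫ AbelianVariety.prodLift (AbelianVariety.fst T T ≫ φT) (AbelianVariety.snd T T ≫ (-φT)) = φ t ≫ gT)
    {F : Type} [Field F] [NumberField F] (ιF : F →+* T.endAlgebra) (hF : Module.finrank ℚ F = 2 * T.dim) (hp : T.dim.Prime) :
    (∀ ηX : complexBetti 𝒳 2, StandardConjectureBStar (2 * q + 1 + 1 + 1) 𝒳 ηX) ↔
      ∀ s : ComplexPoints S, weilClassesOf (A s) (φ s) (q + 1) dK ≤ algebraicClasses (A s).X (q + 1) :=
  lefschetzB_weilPencil_iff_forall_weilClasses_algebraic_of_hodgeConjectureFor_chart_of_verdier hGT hf t ν hν hN hθ mS hmν hchart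
    hRank hOdd Φ hΦ A e φ hφ hK Θ Up Um hspan hΘ hUpt hUmt hUp0
    (isWeilType_of_isogeny_twistedSquare (by omega) hT hdK hφT (hφ t) gT hγ hcomm)
    (hodgeConjectureFor_of_isogeny_twistedSquare_of_endField gT hγ ιF hF hp)

/-- **W₆ THROUGH `B × B̄`: `B⋆` of the 7-fold total space of a compact pencil of `ℚ(√−d_K)`-Weil SIXFOLDS with its `K`-action through a
chart `K`-isogenous to the twisted square `T × T̄` of a threefold `T` with a sextic number field in `End⁰(T)` (a CM threefold `B`;
`E³`) ⟹ the Weil Hodge conjecture for EVERY member — FACT-FREE, no `HC_CM`.** [cite: Andre1996Motifs, §6.3 Lemme 6.3.3 and Remarque 2 (p. 33)]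
[cite: Gordon1999HodgeAVSurvey, Thm. 6.3 with Remark and Thm. 6.4] [cite: vanGeemen1994HodgeAV, 4.9–4.10] -/
theorem weilClassesOf_le_algebraicClasses_forall_of_lefschetzB_sixfoldPencil_of_cmThreefoldTwistedSquareChart {dK : ℕ}
    (hdK : 0 < dK) (hf : IsCompactAbelianPencil f (2 * 2 + 1 + 1))
    (hB : ∀ ηX : complexBetti 𝒳 2, StandardConjectureBStar (2 * 2 + 1 + 1 + 1) 𝒳 ηX)
    (Φ : 𝒳 ⟶ 𝒳) (hΦ : Φ ≫ f = f)
    (A : ComplexPoints S → AbelianVariety ℂ) (e : ∀ s, (A s).X ≅ fiberOver f s) (φ : ∀ s, A s ⟶ A s)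
    (hφ : ∀ s, φ s ≫ φ s = -(dK • 𝟙 (A s)))
    (hK : ∀ s, ∃ Φs : fiberOver f s ⟶ fiberOver f s, Φs ≫ fiberι f s = fiberι f s ≫ Φ ∧ (e s).hom ≫ Φs = (φ s).hom.hom.hom ≫ (e s).hom)
    (Up : complexBetti 𝒳 (2 * 3)) {t : ComplexPoints S}
    (hUpt : complexBetti.map (e t).hom (2 * 3) (complexBetti.map (fiberι f t) (2 * 3) Up) ∈ weilClassesPlus (A t) (φ t) 3 dK)
    (hUp0 : complexBetti.map (fiberι f t) (2 * 3) Up ≠ 0)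
    {T : AbelianVariety ℂ} {φT : T ⟶ T} (hT : T.dim = 3) (hφT : φT ≫ φT = -(dK • 𝟙 T))
    (gT : A t ⟶ T.prod T) (hγ : AbelianVariety.IsIsogeny gT)
    (hcomm : gT ≫ AbelianVariety.prodLift (AbelianVariety.fst T T ≫ φT) (AbelianVariety.snd T T ≫ (-φT)) = φ t ≫ gT)
    {F : Type} [Field F] [NumberField F] (ιF : F →+* T.endAlgebra) (hF : Module.finrank ℚ F = 6)
    (s : ComplexPoints S) : weilClassesOf (A s) (φ s) 3 dK ≤ algebraicClasses (A s).X 3 :=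
  weilClassesOf_le_algebraicClasses_forall_of_lefschetzB_of_twistedSquareChart (q := 2) hdK hf hB Φ hΦ A e φ hφ hK Up hUpt hUp0
    hT hφT gT hγ hcomm ιF (by rw [hF, hT]) (by rw [hT]; norm_num) s

end Rows

/-! ## §4 The non-split habitat of the pencils through `B × B̄` (RING2-MAP AA2.366 (b), kernel form) -/

section Habitat

variable {𝒳 S : SchemeOver ℂ} {f : 𝒳 ⟶ S}

/-- **THE PENCILS THROUGH A NON-SPLIT POLARIZED TWISTED SQUARE LIE ON THE NON-SPLIT COMPONENT, AND `B⋆` OF THEIR TOTAL SPACE IS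
WEIL-HC ALONG THE PENCIL.** Compact pencil `f : 𝒳 ⟶ S` of abelian SIXFOLDS with a global endomorphism `Φ` over `S`, `K`-compatible
charts `(A_s, e_s, φ_s)` (`φ_s² = −d_K`, `d_K ≥ 1`), a projective embedding `E` of `𝒳` with a rational ambient `a ≠ 0`
(`H_K = d_K·E^*a + Φ^*E^*a`, the relative `K`-symmetrised polarization), a global `U₊` with `e_t^*(U₊|X_t) ∈ E₊(A_t, φ_t)`,
`U₊|X_t ≠ 0`; the chart at `t` is `K`-isogenous (`gT`) to the twisted square `(T × T, φ_T × (−φ_T))` of a threefold `T`, and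
`e_t^*(H_K|X_t) = gT^*h` for a class `h` on `T × T` with a non-degenerate discriminant witness of class `[−m]`, `m ∉ Nm(K_dˣ)` (part
O-a/O-b: the weight-`m` Segre class `pr₁^*h_K + m·pr₂^*h_K`). THEN: (i) EVERY member `(A_s, φ_s)` is a Weil sixfold (type `(3, d_K)`),
polarized by `e_s^*(H_K|X_s)` of class `[−m]` and NOT hyperbolic for it — the pencil lies on the NON-SPLIT polarized component
`(3, d_K, [−m])`; (ii) if `T` carries a sextic number field in `End⁰(T)` (the anchors `B × B̄`, `E³ × Ē³`), `B⋆(𝒳, η) ∀η ⟹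
W(A_s, φ_s) ⊆ N³(A_s)` for EVERY member. Fact-free; no `HC_CM`; no Hodge–Weil theorem in print.
[cite: vanGeemen1994HodgeAV, 4.9, Lemma 5.2 (3), 5.3–5.4 and (5.4.1)] [cite: Landherr1936HermitianForms]
[cite: Andre1996Motifs, §6.3 Lemme 6.3.3 and Remarque 2 (p. 33)] [cite: Gordon1999HodgeAVSurvey, Thm. 6.3 with Remark and Thm. 6.4] -/
theorem nonsplit_weilSixfoldPencil_of_twistedSquareChart {dK : ℕ} (hdK : 0 < dK) (hf : IsCompactAbelianPencil f (2 * 2 + 1 + 1))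
    (Φ : 𝒳 ⟶ 𝒳) (hΦ : Φ ≫ f = f)
    (A : ComplexPoints S → AbelianVariety ℂ) (e : ∀ s, (A s).X ≅ fiberOver f s) (φ : ∀ s, A s ⟶ A s)
    (hφ : ∀ s, φ s ≫ φ s = -(dK • 𝟙 (A s)))
    (hK : ∀ s, ∃ Φs : fiberOver f s ⟶ fiberOver f s, Φs ≫ fiberι f s = fiberι f s ≫ Φ ∧ (e s).hom ≫ Φs = (φ s).hom.hom.hom ≫ (e s).hom)
    (E : ProjectiveEmbedding 𝒳) {a : complexBetti (projectiveSpace E.n ℂ) 2} (ha : IsRationalClass a) (ha0 : a ≠ 0)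
    (Up : complexBetti 𝒳 (2 * 3)) {t : ComplexPoints S}
    (hUpt : complexBetti.map (e t).hom (2 * 3) (complexBetti.map (fiberι f t) (2 * 3) Up) ∈ weilClassesPlus (A t) (φ t) 3 dK)
    (hUp0 : complexBetti.map (fiberι f t) (2 * 3) Up ≠ 0)
    {T : AbelianVariety ℂ} {φT : T ⟶ T} (hT : T.dim = 3) (hφT : φT ≫ φT = -(dK • 𝟙 T))
    (gT : A t ⟶ T.prod T) (hγ : AbelianVariety.IsIsogeny gT)
    (hcomm : gT ≫ AbelianVariety.prodLift (AbelianVariety.fst T T ≫ φT) (AbelianVariety.snd T T ≫ (-φT)) = φ t ≫ gT)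
    {h : complexBetti (T.prod T).X 2} {m : ℕ} (hm : 0 < m)
    (hnorm : Units.mk0 (m : ℚ) (Nat.cast_ne_zero.2 hm.ne') ∉ normUnitsSubgroup ℚ (weilField dK))
    (hδ : HasWeilDiscriminantNondeg (T.prod T)
      (AbelianVariety.prodLift (AbelianVariety.fst T T ≫ φT) (AbelianVariety.snd T T ≫ (-φT))) 3 dK h
      (QuotientGroup.mk (-Units.mk0 (m : ℚ) (Nat.cast_ne_zero.2 hm.ne'))))
    (hH : complexBetti.map (e t).hom 2 (complexBetti.map (fiberι f t) 2
      ((dK : ℂ) • complexBetti.map E.ι 2 a + complexBetti.map Φ 2 (complexBetti.map E.ι 2 a))) = complexBetti.map gT.hom.hom.hom 2 h)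
    (s : ComplexPoints S) :
    IsWeilType (A s) (φ s) 3 dK ∧
      HasWeilDiscriminantNondeg (A s) (φ s) 3 dK (complexBetti.map (e s).hom 2 (complexBetti.map (fiberι f s) 2
        ((dK : ℂ) • complexBetti.map E.ι 2 a + complexBetti.map Φ 2 (complexBetti.map E.ι 2 a))))
        (QuotientGroup.mk (-Units.mk0 (m : ℚ) (Nat.cast_ne_zero.2 hm.ne'))) ∧
      ¬ IsHyperbolicWeilType (A s) (φ s) 3 (complexBetti.map (e s).hom 2 (complexBetti.map (fiberι f s) 2
        ((dK : ℂ) • complexBetti.map E.ι 2 a + complexBetti.map Φ 2 (complexBetti.map E.ι 2 a)))) ∧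
      (∀ {F : Type} [Field F] [NumberField F] (_ιF : F →+* T.endAlgebra), Module.finrank ℚ F = 6 →
        (∀ ηX : complexBetti 𝒳 2, StandardConjectureBStar (2 * 2 + 1 + 1 + 1) 𝒳 ηX) →
          weilClassesOf (A s) (φ s) 3 dK ≤ algebraicClasses (A s).X 3) := by
  -- Weil type at the chart (§1), hence everywhere (part L-d with part L-e's transfer of the Weil line)
  have hWt : IsWeilType (A t) (φ t) 3 dK := isWeilType_of_isogeny_twistedSquare (by norm_num) hT hdK hφT (hφ t) gT hγ hcomm
  have hUall : ∀ s, complexBetti.map (e s).hom (2 * 3) (complexBetti.map (fiberι f s) (2 * 3) Up) ∈ weilClassesOf (A s) (φ s) 3 dK :=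
    fun s ↦ Submodule.mem_sup_left (map_chart_fiberι_mem_weilClassesPlus_member_of_member hf Φ hΦ A e φ hK Up hUpt s)
  have hWs : IsWeilType (A s) (φ s) 3 dK := isWeilType_member_of_member hf A e φ hφ Up hUall hWt hUp0 s
  -- the class `[−m]` at the chart, pulled back along `gT`; then §2
  have hδt : HasWeilDiscriminantNondeg (A t) (φ t) 3 dK (complexBetti.map (e t).hom 2 (complexBetti.map (fiberι f t) 2
      ((dK : ℂ) • complexBetti.map E.ι 2 a + complexBetti.map Φ 2 (complexBetti.map E.ι 2 a))))
      (QuotientGroup.mk (-Units.mk0 (m : ℚ) (Nat.cast_ne_zero.2 hm.ne'))) := by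
    rw [hH]; exact hasWeilDiscriminantNondeg_of_isogeny_twistedSquare gT hγ hcomm hδ
  have hne : (QuotientGroup.mk (-Units.mk0 (m : ℚ) (Nat.cast_ne_zero.2 hm.ne')) : weilNormResidueGroup dK) ≠
      QuotientGroup.mk ((-1 : ℚˣ) ^ 3) := by
    rw [Odd.neg_one_pow (by decide : Odd 3)]
    exact (weilNormResidueGroup_mk_neg_ne_mk_neg_one_iff _).2 hnorm
  obtain ⟨hδs, hnh⟩ := not_isHyperbolicWeilType_member_of_member hf (n := 3) (by norm_num) hdK Φ hΦ A e φ hφ hK E ha ha0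
    hWt.dim_eq hδt hne s
  exact ⟨hWs, hδs, hnh, fun ιF hF hB ↦
    weilClassesOf_le_algebraicClasses_forall_of_lefschetzB_sixfoldPencil_of_cmThreefoldTwistedSquareChart hdK hf hB Φ hΦ A e φ hφ
      hK Up hUpt hUp0 hT hφT gT hγ hcomm ιF hF s⟩

end Habitat

end Summit.HodgeConjecture.HodgeConjecture.Ring2.AbelianAll

end
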